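import Summits.QuantumFields.BalabanUV.Beta.D1BFx.GramWeightJetsMixed
import Summits.QuantumFields.BalabanUV.Beta.D1BFx.GhostSplitJetsFree
import Summits.QuantumFields.BalabanUV.Beta.D1BFx.GhostSplitJetsProd

/-!
# `BalabanUV.Beta.D1BFx.GhostHalfCovariant` — road «BF-x» for binder row D1, slot (K), model brick **«TB5-2c-D» = FINDING F-g7-2 AS A THEOREM:
# THE EXACT GHOST SIDE OF ROUTE T UNDER (R2) IS THE HALF-COVARIANT TOWER (WEIGHT 2) PLUS `2S̃ − S` ON THE COARSE GRAM** (ruling ρ-g7-5).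
# MODEL LEVEL (all index types arbitrary finite; no torus object): data = a frozen «gradient» `D₀ : β × σ`, ARBITRARY gradient jets `Dₛ Dₜ Dₛₜ`
# (two-parameter background family), the scalar averaging `Q : κ × σ` with a basis `N` of `ker Q` (`QN = 0`, `det (QQᵀ) ≠ 0`, `det (NᵀN) ≠ 0`,
# `|ρ| + |κ| = |σ|`), a coarse weight `Γ` (mass `S := QᵀΓQ`), a constant `c`.  Derived: `L(U) = D(U)ᵀD(U)` (covariant Laplacian) and its jets, the
# co-frame `T(U) = NᵀL(U)D(U)ᵀ`, the Gram `G(U) = NᵀL(U)²N`, `A(U) = 2G(U)⁻¹` with inverse-jet words, the FROZEN gauge directions `W₀ = D₀N`, and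
# TB5-1's FP-Gram functional `h_Φ := hessT ((W₀ᵀB₀W₀)⁻¹; W₀ᵀB•W₀)`, `B = TᵀAT` (K-TA4G (R2), `GramWeightJetsMixed`).  THEOREM:
#   `h_Φ = 2·hessT ((L₀ + cS)⁻¹; DₛᵀD₀, DₜᵀD₀, DₛₜᵀD₀) + 2·hessT (S̃₀⁻¹; S̃•) − hessT (S₀⁻¹; S•)`,
# `S̃(U) = Q·(D(U)ᵀD₀ + cS)⁻¹·(L(U) + cS)⁻¹·Qᵀ`, `S(U) = Q·(L(U) + cS)⁻²·Qᵀ` (inverse-jet words displayed) — the FULL covariant tower `h[L(U) + cS]`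
# CANCELS; what survives is the HALF-covariant tower `D(U)ᵀ·D₀ + cS` (the rotating `D_U*` against the frozen `D̂`).  Chain: `hessT_gram_split_jets`
# (W-jets 0) → `hessT_inv_words` (A-term = −G-term) → the `S`-terms DIE against `N` (`QN = 0`) so the compressed X- and G-words are those of the
# PRODUCTS `(L+cS)(DᵀD₀+cS)` and `(L+cS)²` → `GhostSplitJetsFree.hessT_compressed_jets_free` (×2) → `GhostSplitJetsProd.hessT_kkt_prod_jets` (×2) → ring.
# Exact-ℚ ∕ numpy cross-checks of the whole chain: `HOME/b2b-balaban-beta-d1-p2/num/` (l.≈25105, kit j114166)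

HONEST FRAMING (cell contract, verbatim): «discharging `BetaPertH` makes Bałaban's UV stability UNCONDITIONAL — a real constructive-QFT
result; it is NOT the continuum limit and NOT the Clay problem.»  HONEST DEPENDENCY (verbatim): «continuum YM on T⁴ ⇐ BetaPertH ∧ nine
spine estimates (0/9 proved); BetaPertH ⇐ (D1) ∧ (D4) ∧ CAP+tail; G-an2-4 gates asym, D1 and NE2/3/4.»  THIS MODULE DISCHARGES NOTHING of
D1 / BetaPertH: [folklore] finite matrix algebra BY NAME over gan24-leaf-03-g44's `GramWeightJetsMixed`, ne9-leaf-02's `GhostSplitJetsFree` and this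
lineage's `GhostSplitJetsProd`.  No `def`, no `def … : Prop`, nothing cited, 0 sorry.  The ROAD instance (`D₀ := D̂` sorted by `e₁`, `N := N̂`, `Q :=`
the fine-torus block mean, legs = K-TB3c letters `(Ggh)^`∕`(CsqK)^`) is one instantiation away (TB5-2c-D′).  NOT summit progress; NOT BetaPertH,
NOT continuum, NOT Clay.

ABSOLUTE RULE (cell, verbatim): «No internally-minted statement may enter as a cited fact. Every hypothesis is either kernel-proved in this
package or a verbatim quotation of a PUBLISHED theorem with page reference. The manuscript(s) under audit are NOT citable for their own
disputed steps — they are the thing under adjudication; programme-internal (2001/route/tribunal) claims are never citable.»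

Unit `b2b-balaban-beta-d1-p2` (road owner, gen 7).
-/

noncomputable section

namespace Summit.QuantumFields.BalabanUV.Beta.D1BFx.GhostHalfCovariant

open Matrix
open scoped BigOperators
open Literature.MathematicalPhysics.QuantumFieldTheory.Balaban1983to89.Beta.Composition (kkt)
open Summit.QuantumFields.BalabanUV.Beta.D1BFx.MixedVarPackedHess (hessT)
open Summit.QuantumFields.BalabanUV.Beta.D1BFx.GramWeightJets (gram₀ gram₁)
open Summit.QuantumFields.BalabanUV.Beta.D1BFx.GramWeightJetsMixed (gramMix hessT_gram_split_jets)
open Summit.QuantumFields.BalabanUV.Beta.D1BFx.GhostSplitJetsFree (hessT_compressed_jets_free)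
open Summit.QuantumFields.BalabanUV.Beta.D1BFx.GhostSplitJetsProd (hessT_kkt_prod_jets)

/-! ## §1 Small algebra -/

section Algebra

variable {ι ρ : Type*} [Fintype ι] [Fintype ρ] [DecidableEq ρ]

omit [Fintype ρ] [DecidableEq ρ] in
/-- [folklore] With a constant basis the first Gram jet is `WᵀB₁W`. -/
theorem gram₁_zero_basis' (W : Matrix ι ρ ℝ) (B₀ B₁ : Matrix ι ι ℝ) : gram₁ W 0 B₀ B₁ = Wᵀ * B₁ * W := by
  simp [gram₁]

omit [Fintype ρ] [DecidableEq ρ] in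
/-- [folklore] With a constant basis the mixed Gram jet is `WᵀBₛₜW`. -/
theorem gramMix_zero_basis' (W : Matrix ι ρ ℝ) (B₀ Bₛ Bₜ Bₛₜ : Matrix ι ι ℝ) : gramMix W 0 0 0 B₀ Bₛ Bₜ Bₛₜ = Wᵀ * Bₛₜ * W := by
  simp [gramMix]

omit [Fintype ι] in
/-- [folklore] `hessT L 0 0 0 = 0`. -/
theorem hessT_zero_jets' (L : Matrix ρ ρ ℝ) : hessT L 0 0 0 = 0 := by
  simp [hessT]

omit [Fintype ι] in
/-- [folklore] **THE `A`-TERM FOR ARBITRARY GRAM WORDS** (inverse-jet rule, self-contained trace algebra): with `A₀ = 2•G₀⁻¹`, `Aₛ = −2•G₀⁻¹GₛG₀⁻¹`,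
`Aₛₜ = 2•(−G₀⁻¹GₛₜG₀⁻¹ + G₀⁻¹GₛG₀⁻¹GₜG₀⁻¹ + G₀⁻¹GₜG₀⁻¹GₛG₀⁻¹)`: `hessT A₀⁻¹ Aₛ Aₜ Aₛₜ = −hessT G₀⁻¹ Gₛ Gₜ Gₛₜ`. -/
theorem hessT_inv_words' (G₀ Gs Gt Gst : Matrix ρ ρ ℝ) (hG : IsUnit G₀.det) :
    hessT ((2 : ℝ) • G₀⁻¹)⁻¹ (-((2 : ℝ) • (G₀⁻¹ * Gs * G₀⁻¹))) (-((2 : ℝ) • (G₀⁻¹ * Gt * G₀⁻¹)))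
        ((2 : ℝ) • (-(G₀⁻¹ * Gst * G₀⁻¹) + G₀⁻¹ * Gs * G₀⁻¹ * Gt * G₀⁻¹ + G₀⁻¹ * Gt * G₀⁻¹ * Gs * G₀⁻¹))
      = -hessT G₀⁻¹ Gs Gt Gst := by
  have hinv : ((2 : ℝ) • G₀⁻¹)⁻¹ = (2 : ℝ)⁻¹ • G₀ := by
    refine Matrix.inv_eq_left_inv ?_
    rw [Matrix.smul_mul, Matrix.mul_smul, smul_smul, Matrix.mul_nonsing_inv _ hG]
    norm_num
  have hGS : G₀ * G₀⁻¹ = 1 := Matrix.mul_nonsing_inv _ hG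
  have red : ∀ X : Matrix ρ ρ ℝ, G₀ * (G₀⁻¹ * X) = X := fun X => by rw [← Matrix.mul_assoc, hGS, Matrix.one_mul]
  rw [hinv]
  unfold hessT
  -- leg × mixed jet
  have e1 : (2 : ℝ)⁻¹ • G₀ * ((2 : ℝ) • (-(G₀⁻¹ * Gst * G₀⁻¹) + G₀⁻¹ * Gs * G₀⁻¹ * Gt * G₀⁻¹ + G₀⁻¹ * Gt * G₀⁻¹ * Gs * G₀⁻¹))
      = -(Gst * G₀⁻¹) + Gs * G₀⁻¹ * Gt * G₀⁻¹ + Gt * G₀⁻¹ * Gs * G₀⁻¹ := by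
    rw [Matrix.smul_mul, Matrix.mul_smul, smul_smul, show (2 : ℝ)⁻¹ * 2 = 1 by norm_num, one_smul, Matrix.mul_add, Matrix.mul_add, Matrix.mul_neg]
    simp only [Matrix.mul_assoc] at red ⊢
    rw [red, red, red]
  -- leg × first jet, twice
  have e2 : (2 : ℝ)⁻¹ • G₀ * -((2 : ℝ) • (G₀⁻¹ * Gs * G₀⁻¹)) * ((2 : ℝ)⁻¹ • G₀ * -((2 : ℝ) • (G₀⁻¹ * Gt * G₀⁻¹))) = Gs * G₀⁻¹ * Gt * G₀⁻¹ := by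
    have f : ∀ X : Matrix ρ ρ ℝ, (2 : ℝ)⁻¹ • G₀ * -((2 : ℝ) • (G₀⁻¹ * X * G₀⁻¹)) = -(X * G₀⁻¹) := by
      intro X
      rw [Matrix.mul_neg, Matrix.smul_mul, Matrix.mul_smul, smul_smul, show (2 : ℝ)⁻¹ * 2 = 1 by norm_num, one_smul]
      simp only [Matrix.mul_assoc] at red ⊢
      rw [red]
    rw [f, f, neg_mul_neg]
    simp only [Matrix.mul_assoc]
  rw [e1, e2, Matrix.trace_add, Matrix.trace_add, Matrix.trace_neg]
  have t1 : (Gst * G₀⁻¹).trace = (G₀⁻¹ * Gst).trace := Matrix.trace_mul_comm _ _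
  have t2 : (Gt * G₀⁻¹ * Gs * G₀⁻¹).trace = (G₀⁻¹ * Gs * (G₀⁻¹ * Gt)).trace := by
    rw [show Gt * G₀⁻¹ * Gs * G₀⁻¹ = (Gt * (G₀⁻¹ * Gs)) * G₀⁻¹ by simp only [Matrix.mul_assoc], Matrix.trace_mul_comm,
      show G₀⁻¹ * (Gt * (G₀⁻¹ * Gs)) = (G₀⁻¹ * Gt) * (G₀⁻¹ * Gs) by simp only [Matrix.mul_assoc], Matrix.trace_mul_comm]
  have t3 : (Gs * G₀⁻¹ * Gt * G₀⁻¹).trace = (G₀⁻¹ * Gs * (G₀⁻¹ * Gt)).trace := by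
    rw [show Gs * G₀⁻¹ * Gt * G₀⁻¹ = (Gs * (G₀⁻¹ * Gt)) * G₀⁻¹ by simp only [Matrix.mul_assoc], Matrix.trace_mul_comm,
      show G₀⁻¹ * (Gs * (G₀⁻¹ * Gt)) = G₀⁻¹ * Gs * (G₀⁻¹ * Gt) by simp only [Matrix.mul_assoc]]
  rw [t1, t2, t3]
  ring

end Algebra

/-! ## §2 The `S`-terms die against a basis of `ker Q` -/

section Die

variable {σ κ ρ : Type*} [Fintype σ] [Fintype κ]

/-- [folklore] `Nᵀ·(QᵀΓQ) = 0` when `QN = 0`. -/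
theorem basisT_mul_S (N : Matrix σ ρ ℝ) (Q : Matrix κ σ ℝ) (Γ : Matrix κ κ ℝ) (hQN : Q * N = 0) : Nᵀ * (Qᵀ * Γ * Q) = 0 := by
  rw [show Nᵀ * (Qᵀ * Γ * Q) = (Q * N)ᵀ * Γ * Q by rw [Matrix.transpose_mul]; simp only [Matrix.mul_assoc], hQN, Matrix.transpose_zero,
    Matrix.zero_mul, Matrix.zero_mul]

/-- [folklore] `(QᵀΓQ)·N = 0` when `QN = 0`. -/
theorem S_mul_basis (N : Matrix σ ρ ℝ) (Q : Matrix κ σ ℝ) (Γ : Matrix κ κ ℝ) (hQN : Q * N = 0) : Qᵀ * Γ * Q * N = 0 := by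
  rw [Matrix.mul_assoc, hQN, Matrix.mul_zero]

/-- [folklore] **SANDWICH LEMMA**: `Nᵀ·(Y + Z·(QᵀΓQ) + (QᵀΓQ)·Z′)·N = Nᵀ·Y·N` when `QN = 0` (any `Z`, `Z′`). -/
theorem sandwich_kill (N : Matrix σ ρ ℝ) (Q : Matrix κ σ ℝ) (Γ : Matrix κ κ ℝ) (hQN : Q * N = 0) (Y Z Z' : Matrix σ σ ℝ) :
    Nᵀ * (Y + Z * (Qᵀ * Γ * Q) + Qᵀ * Γ * Q * Z') * N = Nᵀ * Y * N := by
  rw [Matrix.mul_add, Matrix.mul_add, Matrix.add_mul, Matrix.add_mul,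
    show Nᵀ * (Z * (Qᵀ * Γ * Q)) * N = Nᵀ * Z * (Qᵀ * Γ * Q * N) by simp only [Matrix.mul_assoc], S_mul_basis N Q Γ hQN, Matrix.mul_zero,
    add_zero, show Nᵀ * (Qᵀ * Γ * Q * Z') * N = Nᵀ * (Qᵀ * Γ * Q) * (Z' * N) by simp only [Matrix.mul_assoc], basisT_mul_S N Q Γ hQN,
    Matrix.zero_mul, add_zero]

end Die

/-! ## §3 The theorem -/

section Main

variable {β σ κ ρ : Type*} [Fintype β] [Fintype σ] [Fintype κ] [Fintype ρ] [DecidableEq σ] [DecidableEq κ] [DecidableEq ρ]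

/-- [folklore] **F-g7-2 AS A THEOREM (MODEL LEVEL): THE GHOST SIDE OF ROUTE T UNDER (R2) IS THE HALF-COVARIANT TOWER.**
Data: frozen gradient `D₀ : β × σ` and ARBITRARY jets `Dₛ Dₜ Dₛₜ`; scalar averaging `Q : κ × σ` with a basis `N` of `ker Q`; coarse weight `Γ`, mass
`S := QᵀΓQ`, constant `c`.  With `L₀ = D₀ᵀD₀`, `Lₛ = DₛᵀD₀ + D₀ᵀDₛ`, `Lₛₜ = DₛₜᵀD₀ + DₛᵀDₜ + DₜᵀDₛ + D₀ᵀDₛₜ` (jets of `L(U) = D(U)ᵀD(U)`), the co-frame jets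
`T₀ = NᵀL₀D₀ᵀ`, `Tₛ = Nᵀ(LₛD₀ᵀ + L₀Dₛᵀ)`, `Tₛₜ = Nᵀ(LₛₜD₀ᵀ + LₛDₜᵀ + LₜDₛᵀ + L₀Dₛₜᵀ)` (jets of `NᵀL(U)D(U)ᵀ`), the Gram words `G₀ = NᵀL₀L₀N`,
`Gₛ = Nᵀ(LₛL₀ + L₀Lₛ)N`, `Gₛₜ = Nᵀ(LₛₜL₀ + LₛLₜ + LₜLₛ + L₀Lₛₜ)N`, the inverse-jet words `A₀ = 2•G₀⁻¹`, `Aₛ = −2•G₀⁻¹GₛG₀⁻¹`, `Aₛₜ = 2•(−G₀⁻¹GₛₜG₀⁻¹ + …)`,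
the FROZEN basis `W₀ = D₀N`, and writing `M₀ := L₀ + cS` (= `D₀ᵀD₀ + cS`):
`hessT ((W₀ᵀ(T₀ᵀA₀T₀)W₀)⁻¹; W₀ᵀ·gram₁ T₀ Tₛ A₀ Aₛ·W₀, W₀ᵀ·gram₁ T₀ Tₜ A₀ Aₜ·W₀, W₀ᵀ·gramMix T₀ Tₛ Tₜ Tₛₜ A₀ Aₛ Aₜ Aₛₜ·W₀)`
`= 2·hessT (M₀⁻¹; DₛᵀD₀, DₜᵀD₀, DₛₜᵀD₀) + 2·hessT ((Q(M₀M₀)⁻¹Qᵀ)⁻¹; S̃•) − hessT ((Q(M₀M₀)⁻¹Qᵀ)⁻¹; S•)`,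
the `S̃`-words being the coarse-Gram words of `GhostSplitJetsProd.hessT_kkt_prod_jets` for the factors `(M₀, Lₛ, Lₜ, Lₛₜ)` and `(M₀, DₛᵀD₀, DₜᵀD₀, DₛₜᵀD₀)`,
the `S`-words those for the factors `(M₀, L•)` and `(M₀, L•)`.  Hypotheses: `QN = 0`, `det (QQᵀ) ≠ 0`, `det (NᵀN) ≠ 0`, `|ρ| + |κ| = |σ|`, `IsUnit G₀.det`,
`IsUnit M₀.det`, `IsUnit (Q(M₀M₀)⁻¹Qᵀ).det`. -/
theorem hessT_ghost_halfCovariant (hcard : Fintype.card ρ + Fintype.card κ = Fintype.card σ)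
    (D₀ Dₛ Dₜ Dₛₜ : Matrix β σ ℝ) (Q : Matrix κ σ ℝ) (N : Matrix σ ρ ℝ) (Γ : Matrix κ κ ℝ) (c : ℝ)
    (hQN : Q * N = 0) (hQ : (Q * Qᵀ).det ≠ 0) (hN : (Nᵀ * N).det ≠ 0)
    (hG : IsUnit (Nᵀ * (D₀ᵀ * D₀ * (D₀ᵀ * D₀)) * N).det)
    (hM : IsUnit (D₀ᵀ * D₀ + c • (Qᵀ * Γ * Q)).det)
    (hS : IsUnit (Q * ((D₀ᵀ * D₀ + c • (Qᵀ * Γ * Q)) * (D₀ᵀ * D₀ + c • (Qᵀ * Γ * Q)))⁻¹ * Qᵀ).det) :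
    let L₀ := D₀ᵀ * D₀
    let Lₛ := Dₛᵀ * D₀ + D₀ᵀ * Dₛ
    let Lₜ := Dₜᵀ * D₀ + D₀ᵀ * Dₜ
    let Lₛₜ := Dₛₜᵀ * D₀ + Dₛᵀ * Dₜ + Dₜᵀ * Dₛ + D₀ᵀ * Dₛₜ
    let T₀ : Matrix ρ β ℝ := Nᵀ * L₀ * D₀ᵀ
    let Tₛ : Matrix ρ β ℝ := Nᵀ * (Lₛ * D₀ᵀ + L₀ * Dₛᵀ)
    let Tₜ : Matrix ρ β ℝ := Nᵀ * (Lₜ * D₀ᵀ + L₀ * Dₜᵀ)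
    let Tₛₜ : Matrix ρ β ℝ := Nᵀ * (Lₛₜ * D₀ᵀ + Lₛ * Dₜᵀ + Lₜ * Dₛᵀ + L₀ * Dₛₜᵀ)
    let G₀ : Matrix ρ ρ ℝ := Nᵀ * (L₀ * L₀) * N
    let Gₛ : Matrix ρ ρ ℝ := Nᵀ * (Lₛ * L₀ + L₀ * Lₛ) * N
    let Gₜ : Matrix ρ ρ ℝ := Nᵀ * (Lₜ * L₀ + L₀ * Lₜ) * N
    let Gₛₜ : Matrix ρ ρ ℝ := Nᵀ * (Lₛₜ * L₀ + Lₛ * Lₜ + Lₜ * Lₛ + L₀ * Lₛₜ) * N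
    let A₀ : Matrix ρ ρ ℝ := (2 : ℝ) • G₀⁻¹
    let Aₛ : Matrix ρ ρ ℝ := -((2 : ℝ) • (G₀⁻¹ * Gₛ * G₀⁻¹))
    let Aₜ : Matrix ρ ρ ℝ := -((2 : ℝ) • (G₀⁻¹ * Gₜ * G₀⁻¹))
    let Aₛₜ : Matrix ρ ρ ℝ := (2 : ℝ) • (-(G₀⁻¹ * Gₛₜ * G₀⁻¹) + G₀⁻¹ * Gₛ * G₀⁻¹ * Gₜ * G₀⁻¹ + G₀⁻¹ * Gₜ * G₀⁻¹ * Gₛ * G₀⁻¹)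
    let W₀ : Matrix β ρ ℝ := D₀ * N
    let M₀ : Matrix σ σ ℝ := D₀ᵀ * D₀ + c • (Qᵀ * Γ * Q)
    let Bₛ : Matrix σ σ ℝ := Dₛᵀ * D₀
    let Bₜ : Matrix σ σ ℝ := Dₜᵀ * D₀
    let Bₛₜ : Matrix σ σ ℝ := Dₛₜᵀ * D₀
    hessT (W₀ᵀ * (T₀ᵀ * A₀ * T₀) * W₀)⁻¹ (W₀ᵀ * gram₁ T₀ Tₛ A₀ Aₛ * W₀) (W₀ᵀ * gram₁ T₀ Tₜ A₀ Aₜ * W₀)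
        (W₀ᵀ * gramMix T₀ Tₛ Tₜ Tₛₜ A₀ Aₛ Aₜ Aₛₜ * W₀)
      = 2 * hessT M₀⁻¹ Bₛ Bₜ Bₛₜ
        + 2 * hessT (Q * (M₀ * M₀)⁻¹ * Qᵀ)⁻¹
            (-(Q * (M₀ * M₀)⁻¹ * (Lₛ * M₀ + M₀ * Bₛ) * (M₀ * M₀)⁻¹ * Qᵀ))
            (-(Q * (M₀ * M₀)⁻¹ * (Lₜ * M₀ + M₀ * Bₜ) * (M₀ * M₀)⁻¹ * Qᵀ))
            (-(Q * (M₀ * M₀)⁻¹ * (Lₛₜ * M₀ + Lₛ * Bₜ + Lₜ * Bₛ + M₀ * Bₛₜ) * (M₀ * M₀)⁻¹ * Qᵀ)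
              + Q * (M₀ * M₀)⁻¹ * (Lₛ * M₀ + M₀ * Bₛ) * (M₀ * M₀)⁻¹ * (Lₜ * M₀ + M₀ * Bₜ) * (M₀ * M₀)⁻¹ * Qᵀ
              + Q * (M₀ * M₀)⁻¹ * (Lₜ * M₀ + M₀ * Bₜ) * (M₀ * M₀)⁻¹ * (Lₛ * M₀ + M₀ * Bₛ) * (M₀ * M₀)⁻¹ * Qᵀ)
        - hessT (Q * (M₀ * M₀)⁻¹ * Qᵀ)⁻¹
            (-(Q * (M₀ * M₀)⁻¹ * (Lₛ * M₀ + M₀ * Lₛ) * (M₀ * M₀)⁻¹ * Qᵀ))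
            (-(Q * (M₀ * M₀)⁻¹ * (Lₜ * M₀ + M₀ * Lₜ) * (M₀ * M₀)⁻¹ * Qᵀ))
            (-(Q * (M₀ * M₀)⁻¹ * (Lₛₜ * M₀ + Lₛ * Lₜ + Lₜ * Lₛ + M₀ * Lₛₜ) * (M₀ * M₀)⁻¹ * Qᵀ)
              + Q * (M₀ * M₀)⁻¹ * (Lₛ * M₀ + M₀ * Lₛ) * (M₀ * M₀)⁻¹ * (Lₜ * M₀ + M₀ * Lₜ) * (M₀ * M₀)⁻¹ * Qᵀ
              + Q * (M₀ * M₀)⁻¹ * (Lₜ * M₀ + M₀ * Lₜ) * (M₀ * M₀)⁻¹ * (Lₛ * M₀ + M₀ * Lₛ) * (M₀ * M₀)⁻¹ * Qᵀ) := by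
  intro L₀ Lₛ Lₜ Lₛₜ T₀ Tₛ Tₜ Tₛₜ G₀ Gₛ Gₜ Gₛₜ A₀ Aₛ Aₜ Aₛₜ W₀ M₀ Bₛ Bₜ Bₛₜ
  -- determinant letters
  have hG' : IsUnit G₀.det := hG
  have hT : (T₀ * W₀).det ≠ 0 := by
    have e : T₀ * W₀ = G₀ := by
      show Nᵀ * L₀ * D₀ᵀ * (D₀ * N) = Nᵀ * (L₀ * L₀) * N
      simp only [L₀, Matrix.mul_assoc]
    rw [e]; exact hG'.ne_zero
  have hA : A₀.det ≠ 0 := by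
    show ((2 : ℝ) • G₀⁻¹).det ≠ 0
    rw [Matrix.det_smul]
    exact mul_ne_zero (pow_ne_zero _ two_ne_zero) (Matrix.isUnit_nonsing_inv_det _ hG').ne_zero
  -- K-TA4G Gram split with all `W`-jets zero
  have h := hessT_gram_split_jets T₀ Tₛ Tₜ 0 0 Tₛₜ A₀ Aₛ Aₜ 0 0 Aₛₜ W₀ 0 0 0 0 0 hT hA
  rw [gram₁_zero_basis', gram₁_zero_basis', gramMix_zero_basis', gram₀, gram₀] at h
  simp only [Matrix.mul_zero, add_zero] at h
  rw [h, hessT_inv_words' G₀ Gₛ Gₜ Gₛₜ hG']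
  -- the X-words and the G-words as sandwiches of PRODUCT jets (the `S`-terms die against `N`)
  set S := Qᵀ * Γ * Q with hSdef
  have kill := sandwich_kill N Q Γ hQN
  have hX₀ : T₀ * W₀ = Nᵀ * (M₀ * M₀) * N := by
    show Nᵀ * L₀ * D₀ᵀ * (D₀ * N) = Nᵀ * ((L₀ + c • S) * (L₀ + c • S)) * N
    rw [show (L₀ + c • S) * (L₀ + c • S) = L₀ * L₀ + (c • L₀ + c • c • S) * S + S * (c • L₀) by
      simp only [Matrix.add_mul, Matrix.mul_add, Matrix.smul_mul, Matrix.mul_smul, smul_smul, smul_add]; abel]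
    rw [kill]
    simp only [L₀, Matrix.mul_assoc]
  have hXs : Tₛ * W₀ = Nᵀ * (Lₛ * M₀ + M₀ * Bₛ) * N := by
    show Nᵀ * (Lₛ * D₀ᵀ + L₀ * Dₛᵀ) * (D₀ * N) = Nᵀ * (Lₛ * (L₀ + c • S) + (L₀ + c • S) * Bₛ) * N
    rw [show Lₛ * (L₀ + c • S) + (L₀ + c • S) * Bₛ = (Lₛ * L₀ + L₀ * Bₛ) + (c • Lₛ) * S + S * (c • Bₛ) by
      simp only [Matrix.add_mul, Matrix.mul_add, Matrix.smul_mul, Matrix.mul_smul]; abel, kill]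
    simp only [Bₛ, L₀, Matrix.mul_add, Matrix.add_mul, Matrix.mul_assoc]
  have hXt : Tₜ * W₀ = Nᵀ * (Lₜ * M₀ + M₀ * Bₜ) * N := by
    show Nᵀ * (Lₜ * D₀ᵀ + L₀ * Dₜᵀ) * (D₀ * N) = Nᵀ * (Lₜ * (L₀ + c • S) + (L₀ + c • S) * Bₜ) * N
    rw [show Lₜ * (L₀ + c • S) + (L₀ + c • S) * Bₜ = (Lₜ * L₀ + L₀ * Bₜ) + (c • Lₜ) * S + S * (c • Bₜ) by
      simp only [Matrix.add_mul, Matrix.mul_add, Matrix.smul_mul, Matrix.mul_smul]; abel, kill]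
    simp only [Bₜ, L₀, Matrix.mul_add, Matrix.add_mul, Matrix.mul_assoc]
  have hXst : Tₛₜ * W₀ = Nᵀ * (Lₛₜ * M₀ + Lₛ * Bₜ + Lₜ * Bₛ + M₀ * Bₛₜ) * N := by
    show Nᵀ * (Lₛₜ * D₀ᵀ + Lₛ * Dₜᵀ + Lₜ * Dₛᵀ + L₀ * Dₛₜᵀ) * (D₀ * N)
      = Nᵀ * (Lₛₜ * (L₀ + c • S) + Lₛ * Bₜ + Lₜ * Bₛ + (L₀ + c • S) * Bₛₜ) * N
    rw [show Lₛₜ * (L₀ + c • S) + Lₛ * Bₜ + Lₜ * Bₛ + (L₀ + c • S) * Bₛₜ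
        = (Lₛₜ * L₀ + Lₛ * Bₜ + Lₜ * Bₛ + L₀ * Bₛₜ) + (c • Lₛₜ) * S + S * (c • Bₛₜ) by
      simp only [Matrix.add_mul, Matrix.mul_add, Matrix.smul_mul, Matrix.mul_smul]; abel, kill]
    simp only [Bₛ, Bₜ, Bₛₜ, L₀, Matrix.mul_add, Matrix.add_mul, Matrix.mul_assoc]
  have hG₀ : G₀ = Nᵀ * (M₀ * M₀) * N := by
    show Nᵀ * (L₀ * L₀) * N = Nᵀ * ((L₀ + c • S) * (L₀ + c • S)) * N
    rw [show (L₀ + c • S) * (L₀ + c • S) = L₀ * L₀ + (c • L₀ + c • c • S) * S + S * (c • L₀) by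
      simp only [Matrix.add_mul, Matrix.mul_add, Matrix.smul_mul, Matrix.mul_smul, smul_smul, smul_add]; abel, kill]
  have hGs : Gₛ = Nᵀ * (Lₛ * M₀ + M₀ * Lₛ) * N := by
    show Nᵀ * (Lₛ * L₀ + L₀ * Lₛ) * N = Nᵀ * (Lₛ * (L₀ + c • S) + (L₀ + c • S) * Lₛ) * N
    rw [show Lₛ * (L₀ + c • S) + (L₀ + c • S) * Lₛ = (Lₛ * L₀ + L₀ * Lₛ) + (c • Lₛ) * S + S * (c • Lₛ) by
      simp only [Matrix.add_mul, Matrix.mul_add, Matrix.smul_mul, Matrix.mul_smul]; abel, kill]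
  have hGt : Gₜ = Nᵀ * (Lₜ * M₀ + M₀ * Lₜ) * N := by
    show Nᵀ * (Lₜ * L₀ + L₀ * Lₜ) * N = Nᵀ * (Lₜ * (L₀ + c • S) + (L₀ + c • S) * Lₜ) * N
    rw [show Lₜ * (L₀ + c • S) + (L₀ + c • S) * Lₜ = (Lₜ * L₀ + L₀ * Lₜ) + (c • Lₜ) * S + S * (c • Lₜ) by
      simp only [Matrix.add_mul, Matrix.mul_add, Matrix.smul_mul, Matrix.mul_smul]; abel, kill]
  have hGst : Gₛₜ = Nᵀ * (Lₛₜ * M₀ + Lₛ * Lₜ + Lₜ * Lₛ + M₀ * Lₛₜ) * N := by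
    show Nᵀ * (Lₛₜ * L₀ + Lₛ * Lₜ + Lₜ * Lₛ + L₀ * Lₛₜ) * N = Nᵀ * (Lₛₜ * (L₀ + c • S) + Lₛ * Lₜ + Lₜ * Lₛ + (L₀ + c • S) * Lₛₜ) * N
    rw [show Lₛₜ * (L₀ + c • S) + Lₛ * Lₜ + Lₜ * Lₛ + (L₀ + c • S) * Lₛₜ
        = (Lₛₜ * L₀ + Lₛ * Lₜ + Lₜ * Lₛ + L₀ * Lₛₜ) + (c • Lₛₜ) * S + S * (c • Lₛₜ) by
      simp only [Matrix.add_mul, Matrix.mul_add, Matrix.smul_mul, Matrix.mul_smul]; abel, kill]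
  rw [hX₀, hXs, hXt, hXst, hGs, hGt, hGst]
  rw [show G₀⁻¹ = (Nᵀ * (M₀ * M₀) * N)⁻¹ by rw [hG₀]]
  -- compression to the bordered form (twice)
  have hd : (Nᵀ * (M₀ * M₀) * N).det ≠ 0 := by rw [← hG₀]; exact hG'.ne_zero
  rw [(hessT_compressed_jets_free hcard (M₀ * M₀) _ _ _ Q N hQN hQ hN hd).1,
    (hessT_compressed_jets_free hcard (M₀ * M₀) _ _ _ Q N hQN hQ hN hd).1]
  -- the two product splits
  rw [hessT_kkt_prod_jets M₀ Lₛ Lₜ Lₛₜ M₀ Bₛ Bₜ Bₛₜ Q hM hM hS, hessT_kkt_prod_jets M₀ Lₛ Lₜ Lₛₜ M₀ Lₛ Lₜ Lₛₜ Q hM hM hS]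
  ring

end Main

end Summit.QuantumFields.BalabanUV.Beta.D1BFx.GhostHalfCovariant

end
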